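import Summits.HodgeConjecture.HodgeConjecture.Theorems.HeckePrymWeilHeckePrymAnchorsGlobalClassOfSection
import Literature.AlgebraicGeometry.HodgeTheory.MotivatedClassesDeformationInputs
import Literature.AlgebraicGeometry.HodgeTheory.GlobalInvariantCycles
import HarnessLib

/-!
# Crux `HeckePrymAnchors` (stmt-HodgeConjecture-14496), line `Sketch` v5 — the global class of a flat section from Leray degeneration

The W-engine of the crux WITHOUT the partie fixe and WITHOUT Hironaka. Let `f : 𝒳 ⟶ S` be a
smooth projective family (`IsSmoothProjectiveFamily f n`), projective over `S` in Hartshorne's /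
Voisin's sense (a closed `S`-immersion `𝒳 ↪ ℙᴺ × S`, [VoisinHodgeII2003, Def. 4.14]), over a smooth
quasi-projective IRREDUCIBLE complex base, and `σ : S(ℂ) → FiberClass f k` a continuous section of
the espace étalé of `Rᵏ f_* ℂ`. GRANTED, as a hypothesis spelled out verbatim, the theorem of
Deligne 1968 in the pointwise form of [VoisinHodgeII2003, Thm. 4.18] — the Leray spectral sequence of
a projective submersion degenerates at `E₂` ([Deligne1968, Prop. (2.1) with (2.6.3)];
[VoisinHodgeII2003, Thm. 4.15]), so `Hᵏ(𝒳, ℚ) → Γ(S, Rᵏ f_* ℚ)` is onto and every invariant class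
at `s₀`, i.e. every value `σ(s₀)` of a continuous section, is the restriction of a class of the
total space — there is ONE class `W ∈ Hᵏ(𝒳(ℂ); ℂ)` of the open total space with
`σ(s) = (s, W|_{𝒳_s})` for EVERY `s`.

This hypothesis is the input `h418` of the tree's `deligne_globalInvariantCycles_of_thm418_of_cor3217`
(`HodgeTheory/GlobalInvariantCyclesCoefficientsProofs`), i.e. ONE of the three published inputs of
the partie fixe `deligne_globalInvariantCycles` used by v4 of the line (`stub_globalClassOfSection`,
which needed in addition a Hironaka compactification of `𝒳`): the debt of the W-engine drops from
{Hodge II 4.1.1, Hironaka} to {Deligne 1968}.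

Proof (all steps proved in the tree): the total space is quasi-projective
(`IsQuasiProjectiveOver.of_isClosedImmersion_projectiveSpace_tensor`); `S(ℂ)` is a connected
(`ComplexPoints.connectedSpace_iff_holds`), equidimensional
(`exists_smoothOfRelativeDimension_of_connectedSpace_complexPoints`), path-connected manifold and
`Rᵏ f_* ℂ` is a local system on it (Ehresmann,
`isCohomologicallyLocallyTrivialOn_univ_of_isSmoothProjectiveFamily`); Deligne 1968 at ONE point
`s₀` gives `W` with `σ(s₀) = (s₀, W|_{𝒳_{s₀}})`; the identity principle for continuous sections
(`gcs_section_eq_of_eq`, Voisin II Lemma 4.17) gives `σ = globalSection f k W` everywhere.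
No `sorry`, no definition, no new axiom.
-/

noncomputable section

-- every declaration of this problem lives in `Summit.HodgeConjecture.HodgeConjecture.…` (summit = sub-problem)
set_option linter.dupNamespace false

open CategoryTheory AlgebraicGeometry Limits MonoidalCategory CartesianMonoidalCategory

namespace Summit.HodgeConjecture.HodgeConjecture.Theorems.HeckePrymWeilLine

open Literature.AlgebraicGeometry Literature.AlgebraicGeometry.Motives Literature.AlgebraicGeometry.HodgeTheory

/-- **GLOBAL CLASS OF A FLAT SECTION FROM LERAY DEGENERATION** (W-engine of line `Sketch`, v5).
Granted Deligne 1968 / Voisin II Thm. 4.18 in pointwise form on the real carriers (hypothesis,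
verbatim: for a smooth projective family `f : 𝒳 ⟶ S` with quasi-projective total space over a
smooth quasi-projective base, every value `σ(s₀)` of a continuous section `σ` of `FiberClass.pt` is
the restriction of a class of `Hᵏ(𝒳(ℂ); ℂ)`), every continuous section `σ` of `FiberClass f k → S(ℂ)`
of an EMBEDDED smooth projective family over a smooth quasi-projective IRREDUCIBLE base is the
global section of ONE class `W ∈ Hᵏ(𝒳(ℂ); ℂ)`: the total space is quasi-projective
(`IsQuasiProjectiveOver.of_isClosedImmersion_projectiveSpace_tensor`), the hypothesis at one point
`s₀` gives `W`, and the identity principle for continuous sections of the local system `Rᵏ f_* ℂ`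
over the path-connected `S(ℂ)` (`gcs_section_eq_of_eq`, Ehresmann
`isCohomologicallyLocallyTrivialOn_univ_of_isSmoothProjectiveFamily`) gives `σ = globalSection f k W`.
[cite: VoisinHodgeII2003, Thm. 4.18 (with Thm. 4.15, Lemma 4.17, Def. 4.14)]
[cite: Deligne1968, Prop. (2.1) with (2.6.3)] -/
theorem stub_globalClassOfSection_of_leray :
    (∀ (𝒳 S : SchemeOver ℂ) (f : 𝒳 ⟶ S) (n : ℕ), IsSmoothProjectiveFamily f n → IsQuasiProjectiveOver 𝒳 → IsQuasiProjectiveOver S → AlgebraicGeometry.Smooth S.hom → ∀ (k : ℕ) (σ : ComplexPoints S → FiberClass f k), Continuous σ → (∀ s, (σ s).pt = s) → ∀ s₀ : ComplexPoints S, ∃ β : complexBetti 𝒳 k, σ s₀ = globalSection f k β s₀) → ∀ ⦃𝒳 S : SchemeOver ℂ⦄ (f : 𝒳 ⟶ S) (n k : ℕ), IsSmoothProjectiveFamily f n → (∃ (N : ℕ) (ι : 𝒳 ⟶ projectiveSpace N ℂ ⊗ S), IsClosedImmersion ι.left ∧ ι ≫ snd (projectiveSpace N ℂ) S = f) → AlgebraicGeometry.Smooth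 S.hom → IsQuasiProjectiveOver S → IrreducibleSpace S.left → ∀ (σ : ComplexPoints S → FiberClass f k), Continuous σ → (∀ s, (σ s).pt = s) → ∃ W : complexBetti 𝒳 k, ∀ s, σ s = globalSection f k W s := by
  intro hL 𝒳 S f n k hf hι hS hSqp hSirr σ hσ hpt
  -- (1) the total space is quasi-projective (closed in `ℙᴺ × S`, `S` quasi-projective)
  obtain ⟨N, ι, hιc, _⟩ := hι
  haveI := hιc
  have h𝒳qp : IsQuasiProjectiveOver 𝒳 :=
    IsQuasiProjectiveOver.of_isClosedImmersion_projectiveSpace_tensor ι hSqp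
  -- the base: `S(ℂ)` is a connected manifold, `Rᵏ f_* ℂ` a local system on it
  haveI := hS
  haveI := hSirr
  haveI : LocallyOfFiniteType S.hom := hSqp.locallyOfFiniteType
  haveI : ConnectedSpace (ComplexPoints S) := (ComplexPoints.connectedSpace_iff_holds S).2 inferInstance
  obtain ⟨d, hd⟩ := exists_smoothOfRelativeDimension_of_connectedSpace_complexPoints S
  haveI := hd
  haveI := pathConnectedSpace_complexPoints_of_smoothOfRelativeDimension S d
  have hU := isCohomologicallyLocallyTrivialOn_univ_of_isSmoothProjectiveFamily f d hf hSqp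
  -- (2) Deligne 1968 at one point `s₀`
  obtain ⟨s₀⟩ := (inferInstance : Nonempty (ComplexPoints S))
  obtain ⟨W, hW⟩ := hL 𝒳 S f n hf h𝒳qp hSqp hS k σ hσ hpt s₀
  -- (3) uniqueness of continuous sections
  exact ⟨W, gcs_section_eq_of_eq f k hU hσ hpt (continuous_globalSection f k _) (fun _ => rfl) hW⟩

end Summit.HodgeConjecture.HodgeConjecture.Theorems.HeckePrymWeilLine

end
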